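import Summits.HodgeConjecture.HodgeConjecture.Theorems.Ring2AbelianAllAndrePrimitiveLiftLieberman
import Summits.HodgeConjecture.HodgeConjecture.Theorems.Ring2AbelianAllSpreadFloorUnderNumerical
import HarnessLib

/-!
# Ring 2 · AbelianAll · SPREADING axis, part XIII — the primitive lift UNDER THE FLOOR: `F_CM` against ab-andre-2's
# `[CM primitive lift]` / `[primitive lift at every point]`, `HC_CM`-free modulo Lieberman and Lemme 6.3.1

research route, not a corollary; conditional on HC_CM plus one named minimal statement.

Seat `pub-hodge-ring2-ab-spread-1` (SPREADING), generation 23. Seat ab-andre-2's parts XXI-a/b/c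
(`Ring2AbelianAllAndrePrimitiveLift`, `…Rows`, `…Lieberman`, all landed 2026-08-20) read the fibre-class lift
`(L) = CMFibreAlgebraicLift` and the algebraic fixed part `(L∀) = AlgebraicFixedPart` through the Lefschetz decomposition
of the fibres: `(L) ⟺ [CM primitive lift]` and `(L∀) ⟺ [primitive lift at every point]`, granted ONLY Lieberman's theorem
(`hL`, XXI-c) — display-only shapes (`local notation3`, NO `def`; copied verbatim below, as XXI-c copies XXI-b's). This part
files the rows that put those two shapes against this seat's floor `F_CM = HodgeFailureSpreadsToCMFibre` (part VII; the
`B_min` of record, UNCHANGED), so that the `F_CM` column of the cell's implication table stays complete: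

* §1 ONE PENCIL, ANY `d`: `invariantCyclesHoldFor_of_lieberman_of_primitiveLift` — `hL ⊢` the primitive lift at every point
  of ONE compact pencil of abelian `d`-folds `⟹ (1.1)_f` for that pencil (XXI-b's `invariantCyclesHoldFor_of_relDim_four_of_primitiveLift_two`
  was `d = 4`, fact-free; XXI-c's `compactAbelianPencilVHC_of_lieberman_of_primitiveLiftEverywhere` is the all-pencils node row).
* §2 NODE ROWS, no `HC_CM`: `cmPrimitiveLift_of_lieberman_of_cmPointedPencilNumerical` — `hL ⊢ Num^CM ⟹ [CM primitive lift]`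
  (part XII §1, then XXI-b's fact-free `(L) ⟹` primitive lift; the converse is NOT claimed without `HC_CM`).
* §3 THE FLOOR, no `HC_CM`: `hodgeFailureSpreadsToCMFibre_of_lieberman_of_andre1996_of_cmPrimitiveLift` —
  `hL → h₂₁ → [CM primitive lift] → F_CM`; `hodgeFailureSpreadsToCMFibre_of_lieberman_of_andre1996_of_primitiveLiftEverywhere`
  — `hL → h₂₁ → [primitive lift at every point] → F_CM` (XXI-c §4, then part X's `(L) ⟹[h₂₁] F_CM` / `(L∀) ⟹[h₂₁] F_CM`).
* §4 UNDER THE CELL'S BINDERS (`h₂₁`, Verdier 1976, `HC_CM`; `hL` for the second shape): `F_CM ⟺ [CM primitive lift]`,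
  `F_CM ⟺ [primitive lift at every point]` (two exact complements of `HC_CM` agree under `HC_CM`: part VII's fact-free
  `HC_AV ⟺ HC_CM ∧ F_CM` against XXI-b/c's `HC_AV ⟺ HC_CM ∧ [·]`, Frame `iff_of_exactWithCM_of_HC_CM`); the item readings
  `(HC_CM → F_CM) ⟺ (HC_CM → [CM primitive lift])` modulo [h₂₁, Verdier] (both are `CMToAbelian`; nothing closes the item);
  and the frontier row `bminFrontier_primitiveLift_of_lieberman_of_andre1996_of_verdier`.

## Honest status

Nothing here proves `HC_AV`, `HC_CM`, `CMToAbelian` (stmt-HodgeConjecture-16267 stays OPEN), `(L)`, `(L∀)`, either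
primitive-lift shape, `Num^CM` or `F_CM`; no arrow of the cell's one-way column is reversed and no `HC_CM`-free converse of
§2–§3 is claimed. `B_min` of record for this seat is UNCHANGED (`F_CM`, part VII: exact and fact-free); ab-ref R-47 (iii):
the primitive-lift shape is a re-shaping of the class of `Num^CM` / `(L)`, not a strictly weaker candidate — "minimal" is
claimed nowhere. COUNT ONCE: the mechanism `(L) ↔ primitive lift` and its keying on Lieberman are ab-andre-2's (XXI-a/b/c);
this part's own content is the one-pencil theorem §1 and the compositions §2–§4 on the `F_CM` column. Facts in the
closure: unchanged from part XII (`hL`, `h₂₁`, `hGT` are displayed binders, never discharged).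

## Edge labels (K[…] = kernel theorem modulo the displayed binders)

§1 K[hL] · §2 `Num^CM ⟹ [CM primitive lift]` K[hL] · §3 `[CM primitive lift] ⟹ F_CM`, `[primitive lift everywhere] ⟹ F_CM`
K[hL, h₂₁] · §4 `F_CM ⟺ [CM primitive lift]` K[h₂₁, Verdier, HC_CM], `F_CM ⟺ [primitive lift everywhere]`
K[h₂₁, Verdier, hL, HC_CM], item readings K[h₂₁, Verdier], frontier K[hL, h₂₁, Verdier].

References: [cite: Lieberman1968, main theorem] · [cite: Kleiman1968AlgebraicCycles, §3 (A(X), D(X))] ·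
[cite: Andre1996Motifs, Lemme 6.3.1 (p. 31), §6.3 a) and Remarque 2 (p. 33)] · [cite: Milne2020HodgeClassesAV, Prop. 1 (p. 7)] ·
[cite: Abdulali1994FamiliesAV, (1.1) (p. 1122)] · [cite: Verdier1976, Cor. (5.1)].
-/

set_option linter.dupNamespace false

namespace Summit.HodgeConjecture.HodgeConjecture.Ring2.AbelianAll

open CategoryTheory AlgebraicGeometry
open Literature.AlgebraicGeometry Literature.AlgebraicGeometry.Motives
open Literature.AlgebraicGeometry.HodgeTheory
open Literature.AlgebraicTopology.SingularHomology (singularCohomology cupProduct)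
open Literature.Geometry.Kaehler (lefschetzOperator lefschetzPow HasHardLefschetzProperty)
open Literature.AlgebraicGeometry.Deligne1982 (cmLocus)
open Literature.AlgebraicGeometry.Abdulali1994 (InvariantCyclesHoldFor)
open Literature.AlgebraicGeometry.Andre1996 (andre1996_cmAnchoredPencil)
open Summit.HodgeConjecture.HodgeConjecture
open Summit.HodgeConjecture.HodgeConjecture.Theses
open Summit.HodgeConjecture.HodgeConjecture.Theses.RankFourFaces (CMAbelianHodge CMToAbelian)
open Summit.HodgeConjecture.HodgeConjecture.Theses.PadicSemiregularLift (HodgeAbelianVarieties)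

variable {𝒳 S : SchemeOver ℂ}

/-! ## §1 One compact pencil, any `d`: the primitive lift at every point gives `(1.1)_f`, modulo Lieberman -/

/-- **`hL ⊢` the primitive lift at every point of ONE compact pencil of abelian `d`-folds `⟹ (1.1)_f` for that pencil, ANY
`d`** (XXI-b's `invariantCyclesHoldFor_of_relDim_four_of_primitiveLift_two` was `d = 4`, fact-free): at each point `s` the primitive lift
gives `j_s^{*-1} C^p(X_s) = C^p(𝒳) + ker j_s^*` (ab-andre-2's XXI-c `forall_comap_le_sup_iff_primitiveLift_of_lieberman` and
`algebraicClasses_sup_ker_le_comap`), a subspace independent of `s` (`algebraicClasses_sup_ker_eq`), which is `(1.1)_f`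
(`invariantCyclesHoldFor_iff_comap_eq`). `K ∈ C¹(𝒳)` is any global algebraic class polarising every fibre (one exists:
`exists_algebraic_globalPolarization`). [cite: Abdulali1994FamiliesAV, (1.1) (p. 1122)] [cite: Lieberman1968, main theorem]
[cite: Milne2020HodgeClassesAV, Prop. 1 (p. 7)] -/
theorem invariantCyclesHoldFor_of_lieberman_of_primitiveLift (hL : Lieberman1968_lefschetzInvolution_algebraic_abelianVariety)
    {d : ℕ} {f : 𝒳 ⟶ S} (hf : IsCompactAbelianPencil f d) {K : complexBetti 𝒳 2} (hKalg : K ∈ algebraicClasses 𝒳 1)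
    (hKs : ∀ s : ComplexPoints S, IsPolarizationClass d (fiberOver f s) (complexBetti.map (fiberι f s) 2 K))
    (hPrim : ∀ (s : ComplexPoints S) (r : ℕ), 2 ≤ r → 2 * r ≤ d → ∀ ξ ∈ algebraicClasses (fiberOver f s) r,
      ξ ∈ primitiveClasses (complexBetti.map (fiberι f s) 2 K) d (2 * r) →
      ξ ∈ LinearMap.range (complexBetti.map (fiberι f s) (2 * r)).hom →
      ξ ∈ (algebraicClasses 𝒳 r).map (complexBetti.map (fiberι f s) (2 * r)).hom) :
    InvariantCyclesHoldFor f d := by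
  have hle : ∀ (s : ComplexPoints S) (p : ℕ),
      (algebraicClasses (fiberOver f s) p).comap (complexBetti.map (fiberι f s) (2 * p)).hom ≤
        algebraicClasses 𝒳 p ⊔ LinearMap.ker (complexBetti.map (fiberι f s) (2 * p)).hom :=
    fun s ↦ (forall_comap_le_sup_iff_primitiveLift_of_lieberman hL hf s hKalg hKs).2 (hPrim s)
  rw [invariantCyclesHoldFor_iff_comap_eq hf]
  intro p s s'
  rw [le_antisymm (hle s p) (algebraicClasses_sup_ker_le_comap hf p s),
    le_antisymm (hle s' p) (algebraicClasses_sup_ker_le_comap hf p s'), algebraicClasses_sup_ker_eq hf p s s']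

/-! ## §2 Node rows without `HC_CM`: `Num^CM ⟹ [CM primitive lift]`, modulo Lieberman -/

/-- Display-only shape of the CM PRIMITIVE LIFT (no `def` is made; copied verbatim from seat ab-andre-2's parts XXI-b/c): on
every compact pencil of abelian `d`-folds, at every CM point `t`, for every global algebraic class `K` polarising every fibre
and every `2 ≤ r ≤ d/2`, every `K|_{X_t}`-primitive algebraic class of degree `2r` on `X_t` lying in `Im j_t^*` lies in
`j_t^* N^r(𝒳)`. -/
local notation3 (prettyPrint := false) "CMPrimitiveLift[]" =>
  ∀ ⦃d : ℕ⦄ ⦃𝒳 S : SchemeOver ℂ⦄ (f : 𝒳 ⟶ S) (_ : IsCompactAbelianPencil f d) (t : ComplexPoints S),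
    t ∈ cmLocus f d → ∀ (K : complexBetti 𝒳 2), K ∈ algebraicClasses 𝒳 1 →
    (∀ s : ComplexPoints S, IsPolarizationClass d (fiberOver f s) (complexBetti.map (fiberι f s) 2 K)) →
    ∀ r, 2 ≤ r → 2 * r ≤ d → ∀ ξ ∈ algebraicClasses (fiberOver f t) r,
      ξ ∈ primitiveClasses (complexBetti.map (fiberι f t) 2 K) d (2 * r) →
      ξ ∈ LinearMap.range (complexBetti.map (fiberι f t) (2 * r)).hom →
      ξ ∈ (algebraicClasses 𝒳 r).map (complexBetti.map (fiberι f t) (2 * r)).hom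

/-- Display-only shape (no `def`; copied verbatim from ab-andre-2's part XXI-c): the PRIMITIVE LIFT AT EVERY POINT of every
compact pencil of abelian varieties. -/
local notation3 (prettyPrint := false) "PrimitiveLiftEverywhere[]" =>
  ∀ ⦃d : ℕ⦄ ⦃𝒳 S : SchemeOver ℂ⦄ (f : 𝒳 ⟶ S) (_ : IsCompactAbelianPencil f d) (t : ComplexPoints S)
    (K : complexBetti 𝒳 2), K ∈ algebraicClasses 𝒳 1 →
    (∀ s : ComplexPoints S, IsPolarizationClass d (fiberOver f s) (complexBetti.map (fiberι f s) 2 K)) →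
    ∀ r, 2 ≤ r → 2 * r ≤ d → ∀ ξ ∈ algebraicClasses (fiberOver f t) r,
      ξ ∈ primitiveClasses (complexBetti.map (fiberι f t) 2 K) d (2 * r) →
      ξ ∈ LinearMap.range (complexBetti.map (fiberι f t) (2 * r)).hom →
      ξ ∈ (algebraicClasses 𝒳 r).map (complexBetti.map (fiberι f t) (2 * r)).hom

/-- **`hL ⊢ Num^CM ⟹ [CM primitive lift]`, no `HC_CM`** (part XII §1 `hL ⊢ Num^CM ⟹ (L)`, then ab-andre-2's fact-free
`(L) ⟹ [CM primitive lift]`, XXI-b). The converse is NOT claimed without `HC_CM` (`(L) ⟹ Num^CM` needs the Hodge classes of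
`Im j_t^*` algebraic, XXI-b §5). [cite: Kleiman1968AlgebraicCycles, §3 Cor. 3.9 (A ⇒ D)] [cite: Lieberman1968, main theorem] -/
theorem cmPrimitiveLift_of_lieberman_of_cmPointedPencilNumerical
    (hL : Lieberman1968_lefschetzInvolution_algebraic_abelianVariety) (hNum : CMPointedPencilNumerical) : CMPrimitiveLift[] :=
  cmPrimitiveLift_of_cmFibreAlgebraicLift (cmFibreAlgebraicLift_of_lieberman_of_cmPointedPencilNumerical hL hNum)

/-! ## §3 The floor without `HC_CM`: both primitive-lift shapes imply `F_CM`, modulo Lieberman and Lemme 6.3.1 -/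

/-- **`hL → h₂₁ → [CM primitive lift] → F_CM`, no `HC_CM`** (XXI-c's `hL ⊢ [CM primitive lift] ⟹ (L)`, then part X's
`(L) ⟹[h₂₁] F_CM`): granted Lieberman's theorem and André's Lemme 6.3.1, the CM primitive lift implies this seat's `B_min`
of record. `hL`, `h₂₁` BINDERS (named facts). research route, not a corollary; conditional on HC_CM plus one named minimal
statement. [cite: Andre1996Motifs, Lemme 6.3.1 (p. 31) and §6.3 a) (p. 33)] [cite: Lieberman1968, main theorem] -/
theorem hodgeFailureSpreadsToCMFibre_of_lieberman_of_andre1996_of_cmPrimitiveLift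
    (hL : Lieberman1968_lefschetzInvolution_algebraic_abelianVariety) (h₂₁ : andre1996_cmAnchoredPencil)
    (hPrim : CMPrimitiveLift[]) : HodgeFailureSpreadsToCMFibre :=
  hodgeFailureSpreadsToCMFibre_of_andre1996_of_cmFibreAlgebraicLift h₂₁
    ((cmFibreAlgebraicLift_iff_cmPrimitiveLift_of_lieberman hL).2 hPrim)

/-- **`hL → h₂₁ → [primitive lift at every point] → F_CM`, no `HC_CM`** (XXI-c's `hL ⊢ [primitive lift everywhere] ⟹ (L∀)`,
then part X's `(L∀) ⟹[h₂₁] F_CM`). `hL`, `h₂₁` BINDERS. [cite: Andre1996Motifs, Lemme 6.3.1 (p. 31) and Remarque 2 (p. 33)]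
[cite: Lieberman1968, main theorem] -/
theorem hodgeFailureSpreadsToCMFibre_of_lieberman_of_andre1996_of_primitiveLiftEverywhere
    (hL : Lieberman1968_lefschetzInvolution_algebraic_abelianVariety) (h₂₁ : andre1996_cmAnchoredPencil)
    (hPrim : PrimitiveLiftEverywhere[]) : HodgeFailureSpreadsToCMFibre :=
  hodgeFailureSpreadsToCMFibre_of_andre1996_of_algebraicFixedPart h₂₁
    ((algebraicFixedPart_iff_primitiveLiftEverywhere_of_lieberman hL).2 hPrim)

/-- **The `HC_CM`-free part of the primitive column under the floor, in one row**: `hL, h₂₁ ⊢ (Num^CM ⟹ [CM primitive lift])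
∧ ([CM primitive lift] ⟹ F_CM) ∧ ([primitive lift everywhere] ⟹ [CM primitive lift])` (the last conjunct is trivial: CM
points are points). No converse claimed. [cite: Andre1996Motifs, §6.3 (p. 33)] [cite: Lieberman1968, main theorem] -/
theorem spreadFloor_below_primitiveLift (hL : Lieberman1968_lefschetzInvolution_algebraic_abelianVariety)
    (h₂₁ : andre1996_cmAnchoredPencil) :
    (CMPointedPencilNumerical → CMPrimitiveLift[]) ∧ (CMPrimitiveLift[] → HodgeFailureSpreadsToCMFibre) ∧
      (PrimitiveLiftEverywhere[] → CMPrimitiveLift[]) :=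
  ⟨cmPrimitiveLift_of_lieberman_of_cmPointedPencilNumerical hL,
    hodgeFailureSpreadsToCMFibre_of_lieberman_of_andre1996_of_cmPrimitiveLift hL h₂₁,
    fun h _ _ _ f hf t _ K hKalg hKs ↦ h f hf t K hKalg hKs⟩

/-! ## §4 Under the cell's binders: `F_CM ⟺` each primitive-lift shape; the item readings; the frontier row -/

/-- **Under the binders `h₂₁`, Verdier 1976 and `HC_CM`: `F_CM ⟺ [CM primitive lift]`** — both are then `⟺ HC_AV` (part
VII's fact-free `HC_AV ⟺ HC_CM ∧ F_CM`, i.e. `ExactWithCM F_CM`, against ab-andre-2's XXI-b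
`HC_AV_iff_HC_CM_and_cmPrimitiveLift_of_verdier`), combined by the Frame's `iff_of_exactWithCM_of_HC_CM`. `h₂₁`, `hGT`, `HC_CM`
BINDERS. [cite: Verdier1976, Cor. (5.1)] [cite: Andre1996Motifs, Lemme 6.3.1 (p. 31)] -/
theorem hodgeFailureSpreadsToCMFibre_iff_cmPrimitiveLift_of_andre1996_of_verdier_of_HC_CM
    (h₂₁ : andre1996_cmAnchoredPencil) (hGT : Verdier1976_genericLocalTriviality) (hCM : CMAbelianHodge) :
    HodgeFailureSpreadsToCMFibre ↔ CMPrimitiveLift[] :=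
  iff_of_exactWithCM_of_HC_CM exactWithCM_hodgeFailureSpreadsToCMFibre
    (HC_AV_iff_HC_CM_and_cmPrimitiveLift_of_verdier h₂₁ hGT) hCM

/-- **Under the binders `h₂₁`, Verdier 1976, `hL` and `HC_CM`: `F_CM ⟺ [primitive lift at every point]`** (part VII against
XXI-c's `HC_AV_iff_HC_CM_and_primitiveLiftEverywhere_of_verdier_of_lieberman`). [cite: Verdier1976, Cor. (5.1)]
[cite: Lieberman1968, main theorem] [cite: Andre1996Motifs, Lemme 6.3.1 (p. 31) and Remarque 2 (p. 33)] -/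
theorem hodgeFailureSpreadsToCMFibre_iff_primitiveLiftEverywhere_of_andre1996_of_verdier_of_lieberman_of_HC_CM
    (h₂₁ : andre1996_cmAnchoredPencil) (hGT : Verdier1976_genericLocalTriviality)
    (hL : Lieberman1968_lefschetzInvolution_algebraic_abelianVariety) (hCM : CMAbelianHodge) :
    HodgeFailureSpreadsToCMFibre ↔ PrimitiveLiftEverywhere[] :=
  iff_of_exactWithCM_of_HC_CM exactWithCM_hodgeFailureSpreadsToCMFibre
    (HC_AV_iff_HC_CM_and_primitiveLiftEverywhere_of_verdier_of_lieberman h₂₁ hGT hL) hCM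

/-- **The item, two readings, modulo Lemme 6.3.1 and Verdier: `(HC_CM → F_CM) ⟺ (HC_CM → [CM primitive lift])`** — both
sides are `CMToAbelian` (part VII `modCM_hodgeFailureSpreadsToCMFibre_iff_cmToAbelian`, fact-free; Frame
`modCM_iff_cmToAbelian_of_exactWithCM` on XXI-b's exactness). Nothing closes the item: stmt-HodgeConjecture-16267 stays
OPEN. [cite: Andre1996Motifs, Remarque 2 (p. 33)] [cite: Verdier1976, Cor. (5.1)] -/
theorem modCM_hodgeFailureSpreadsToCMFibre_iff_modCM_cmPrimitiveLift_of_andre1996_of_verdier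
    (h₂₁ : andre1996_cmAnchoredPencil) (hGT : Verdier1976_genericLocalTriviality) :
    ModCM HodgeFailureSpreadsToCMFibre ↔ (CMAbelianHodge → CMPrimitiveLift[]) :=
  modCM_hodgeFailureSpreadsToCMFibre_iff_cmToAbelian.trans
    (modCM_iff_cmToAbelian_of_exactWithCM (HC_AV_iff_HC_CM_and_cmPrimitiveLift_of_verdier h₂₁ hGT)).symm

/-- **THE PRIMITIVE-LIFT BRACKET AGAINST THE `B_min` FRONTIER OF RECORD, on the axis's facts of record {hL, h₂₁, Verdier}**:
`HC_CM`-FREE the column is ORDERED — `Num^CM ⟹ [CM primitive lift] ⟹ F_CM` modulo [hL, h₂₁] (§2, §3) — and UNDER `HC_CM`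
it COLLAPSES — `F_CM ⟺ [CM primitive lift]` modulo [h₂₁, Verdier] (§4). No `HC_CM`-free converse claimed; 'minimal' claimed
for nothing (F-ab-4, F-ab-81; ab-ref R-47 (iii): the bracket re-shapes the class of `Num^CM`, it is not strictly weaker);
`B_min` of record `F_CM` unchanged. `hL`, `h₂₁`, `hGT` BINDERS (named facts); `HC_CM` a binder inside the third conjunct.
research route, not a corollary; conditional on HC_CM plus one named minimal statement. [cite: Lieberman1968, main theorem]
[cite: Andre1996Motifs, Lemme 6.3.1 (p. 31) and §6.3 (p. 33)] [cite: Verdier1976, Cor. (5.1)] -/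
theorem bminFrontier_primitiveLift_of_lieberman_of_andre1996_of_verdier
    (hL : Lieberman1968_lefschetzInvolution_algebraic_abelianVariety) (h₂₁ : andre1996_cmAnchoredPencil)
    (hGT : Verdier1976_genericLocalTriviality) :
    (CMPointedPencilNumerical → CMPrimitiveLift[]) ∧ (CMPrimitiveLift[] → HodgeFailureSpreadsToCMFibre) ∧
      (CMAbelianHodge → (HodgeFailureSpreadsToCMFibre ↔ CMPrimitiveLift[])) :=
  ⟨cmPrimitiveLift_of_lieberman_of_cmPointedPencilNumerical hL,
    hodgeFailureSpreadsToCMFibre_of_lieberman_of_andre1996_of_cmPrimitiveLift hL h₂₁,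
    hodgeFailureSpreadsToCMFibre_iff_cmPrimitiveLift_of_andre1996_of_verdier_of_HC_CM h₂₁ hGT⟩

end Summit.HodgeConjecture.HodgeConjecture.Ring2.AbelianAll
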